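import Mathlib
import Summits.CriticalPhenomena.CardyFormulaZ2.Theorems.CardyWhiteToColouredDriftBoundPlackettDefs
import Summits.CriticalPhenomena.CardyFormulaZ2.Theorems.CardyWhiteToColouredDriftBoundPlackettVar
import Summits.CriticalPhenomena.CardyFormulaZ2.Theorems.CardyWhiteToColouredDriftBoundStubSignLawSelfDual
import Summits.CriticalPhenomena.CardyFormulaZ2.Theorems.CardyWhiteToColouredNoiseDiscretisationSignMeasurable

/-!
# Plackett/Piterbarg drift of the noise heat flow: removing the noise regularisation

Helper file for crux item `DriftBound` (stmt-CriticalPhenomena-4596) of route `CardyWhiteToColoured`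
(`CardyFormulaZ2`), line `registered` (`Cruxes/DriftBound/Lines/birth.lean`, skeleton v4, lead c3),
stub S3 `stub_regLimit`: the limit `η → 0⁺` of the **regularised flow**

  `regFlow I A η σ = E_ξ[ P_ζ( {e ∈ I | X̃_e(ξ) + η ζ_e > 0} ∈ A ) ]`,

`X̃_e(ξ) = normNoise σ ξ (m e)` the variance-normalised smoothed lattice white noise read at the
medial point of the edge `e`, `ζ_e` (`e ∈ I`) independent standard Gaussians, is the probability
`P_ξ({e ∈ I | X̃_e(ξ) > 0} ∈ A)` that the event `A` occurs for the sign configuration of the field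
itself. Two dominated convergences with bound `1` on probability spaces:

* measurability (`rl_measurableSet_cfg_mem`): whatever the event `A`, the set of inputs whose
  sign configuration lies in `A` is measurable, because the configuration factors through the
  sign pattern, a measurable map into the finite measurable space `Set I`; with Mathlib's
  measurability of the measure of sections (`measurable_measure_prodMk_left`) this makes the
  regularised indicator `regIndicator I A η` a measurable function (`rl_measurable_regIndicator`);
* inner limit (`rl_tendsto_regIndicator`): off the coordinate hyperplanes (`x_i ≠ 0` for all
  `i`), for every fixed `ζ` the signs of `x_i + η ζ_i` and `x_i` agree for `η` near `0`
  (`rl_eventually_sign_iff`, finitely many coordinates), so the indicator is eventually constant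
  and dominated convergence over `ζ` gives `regIndicator I A η x → regIndicator I A 0 x`;
* outer limit (`stub_regLimit`): almost surely no coordinate `X̃_e(ξ)` vanishes
  (`sd_ae_smoothedNoise_ne_zero`, `pl_normNoise_ne_zero_iff`), so dominated convergence over `ξ`
  gives `regFlow I A η σ → E_ξ[regIndicator I A 0 (X̃ ξ)]`, and the integrand at `η = 0` is the
  indicator of `{ξ | {e ∈ I | X̃_e(ξ) > 0} ∈ A}`.

The convergence in fact holds along `𝓝 0`; the registered statement is its restriction to
`𝓝[>] 0`.

References: D. Beliaev, S. Muirhead, A. Rivera, Ann. Probab. 48 (2020), §2.2 (Piterbarg's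
formula; regularisation of indicators of topological events); S. Muirhead, H. Vanneuville,
Ann. Inst. H. Poincaré Probab. Stat. 56 (2020), §2.1 (discretised white noise).
-/

noncomputable section

namespace Summit.CriticalPhenomena.CardyFormulaZ2.Cruxes.DriftBound.Birth

open Set Filter Topology MeasureTheory ProbabilityTheory
open Literature.Probability.LatticeModels Literature.Probability.Percolation
open Summit.CriticalPhenomena.CardyFormulaZ2.Theorems.WhiteToColoured

/-! ### Measurability of sign-configuration events -/

/-- **Sign-configuration events are measurable, whatever the event.** For measurable real
functions `f_i` indexed by the finite edge set `I`, the set of `ω` whose configuration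
`{e ∈ I | f_e(ω) > 0}` lies in `A` is measurable: the configuration factors through the sign
pattern `ω ↦ {i | f_i(ω) > 0}`, a measurable map into the finite measurable space `Set I`, all of
whose subsets are measurable. -/
theorem rl_measurableSet_cfg_mem {Ω : Type*} [MeasurableSpace Ω] (I : Finset (Sym2 (Site 2)))
    (A : Set (Set (Sym2 (Site 2)))) (f : I → Ω → ℝ) (hf : ∀ i, Measurable (f i)) :
    MeasurableSet {ω | {e : Sym2 (Site 2) | ∃ h : e ∈ I, 0 < f ⟨e, h⟩ ω} ∈ A} := by
  have hg : Measurable fun ω => ({i : I | 0 < f i ω} : Set I) :=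
    measurable_set_iff.2 fun i => measurableSet_setOf.1 (measurableSet_lt measurable_const (hf i))
  have hB : MeasurableSet {S : Set I | {e : Sym2 (Site 2) | ∃ h : e ∈ I, (⟨e, h⟩ : I) ∈ S} ∈ A} :=
    (Set.toFinite _).measurableSet
  exact hB.preimage hg

/-- The variance-normalised field at a point is a measurable function of the noise. -/
theorem rl_measurable_normNoise (σ : ℝ) (x : ℂ) :
    Measurable fun ξ : (zdGraph 2).edgeSet → ℝ => normNoise σ ξ x := by
  unfold normNoise
  exact (measurable_smoothedNoise σ 1 x).div_const _

/-- **The regularised indicator is measurable** (for every `η`, smoothness not needed): it is the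
Gaussian measure of the `x`-section of the measurable set
`{(x, ζ) | {e ∈ I | x_e + η ζ_e > 0} ∈ A}` (`measurable_measure_prodMk_left`). -/
theorem rl_measurable_regIndicator (I : Finset (Sym2 (Site 2))) (A : Set (Set (Sym2 (Site 2))))
    (η : ℝ) : Measurable (regIndicator I A η) := by
  have hT : MeasurableSet {p : (I → ℝ) × (I → ℝ) |
      {e : Sym2 (Site 2) | ∃ h : e ∈ I, 0 < p.1 ⟨e, h⟩ + η * p.2 ⟨e, h⟩} ∈ A} :=
    rl_measurableSet_cfg_mem I A (fun i (p : (I → ℝ) × (I → ℝ)) => p.1 i + η * p.2 i) fun i => by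
      fun_prop
  have h := (measurable_measure_prodMk_left
    (ν := Measure.pi fun _ : I => gaussianReal 0 1) hT).ennreal_toReal
  unfold regIndicator
  exact h

/-! ### The inner limit: the regularised indicator off the coordinate hyperplanes -/

/-- **Sign stability.** If no coordinate of `x` vanishes then, for every fixed `ζ`, the signs of
`x_i + η ζ_i` and `x_i` agree for all `i` once `η` is close enough to `0` (finitely many
coordinates, each `η ↦ x_i + η ζ_i` being continuous with non-zero value at `η = 0`). -/
theorem rl_eventually_sign_iff {I : Finset (Sym2 (Site 2))} (x ζ : I → ℝ) (hx : ∀ i, x i ≠ 0) :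
    ∀ᶠ η in 𝓝 (0 : ℝ), ∀ i, (0 < x i + η * ζ i ↔ 0 < x i) := by
  refine Filter.eventually_all.2 fun i => ?_
  have ht : Tendsto (fun η : ℝ => x i + η * ζ i) (𝓝 0) (𝓝 (x i)) :=
    (continuous_const.add (continuous_id.mul continuous_const)).tendsto' 0 (x i) (by simp)
  rcases lt_or_gt_of_ne (hx i) with hneg | hpos
  · exact (ht.eventually_lt_const hneg).mono fun η hη =>
      iff_of_false (not_lt.2 hη.le) (not_lt.2 hneg.le)
  · exact (ht.eventually_const_lt hpos).mono fun η hη => iff_of_true hη hpos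

/-- **Inner limit.** Off the coordinate hyperplanes the regularised indicator is continuous at
`η = 0`: `regIndicator I A η x → regIndicator I A 0 x` as `η → 0`. Write the Gaussian measure of
the event as the integral of its indicator; for every fixed `ζ` the indicator is eventually
constant in `η` (`rl_eventually_sign_iff`), and dominated convergence (bound `1`) applies. -/
theorem rl_tendsto_regIndicator (I : Finset (Sym2 (Site 2))) (A : Set (Set (Sym2 (Site 2))))
    {x : I → ℝ} (hx : ∀ i, x i ≠ 0) :
    Tendsto (fun η : ℝ => regIndicator I A η x) (𝓝 0) (𝓝 (regIndicator I A 0 x)) := by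
  set γ : Measure (I → ℝ) := Measure.pi fun _ : I => gaussianReal 0 1 with hγ
  set S : ℝ → Set (I → ℝ) := fun η =>
    {ζ | {e : Sym2 (Site 2) | ∃ h : e ∈ I, 0 < x ⟨e, h⟩ + η * ζ ⟨e, h⟩} ∈ A} with hS
  have hSm : ∀ η, MeasurableSet (S η) := fun η =>
    rl_measurableSet_cfg_mem I A (fun i (ζ : I → ℝ) => x i + η * ζ i) fun i => by fun_prop
  have hreg : ∀ η, regIndicator I A η x = ∫ ζ, (S η).indicator 1 ζ ∂γ := fun η =>
    (integral_indicator_one (hSm η)).symm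
  simp_rw [hreg]
  refine tendsto_integral_filter_of_dominated_convergence (fun _ => (1 : ℝ)) ?_ ?_ ?_ ?_
  · exact Eventually.of_forall fun η => aestronglyMeasurable_const.indicator (hSm η)
  · refine Eventually.of_forall fun η => ae_of_all _ fun ζ => ?_
    exact (norm_indicator_le_norm_self _ _).trans_eq (by simp)
  · exact integrable_const _
  · refine ae_of_all _ fun ζ => tendsto_const_nhds.congr' ?_
    filter_upwards [rl_eventually_sign_iff x ζ hx] with η hη
    have h1 : {e : Sym2 (Site 2) | ∃ h : e ∈ I, 0 < x ⟨e, h⟩ + η * ζ ⟨e, h⟩} =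
        {e | ∃ h : e ∈ I, 0 < x ⟨e, h⟩} :=
      Set.ext fun e => exists_congr fun h => hη ⟨e, h⟩
    have h0 : {e : Sym2 (Site 2) | ∃ h : e ∈ I, 0 < x ⟨e, h⟩ + 0 * ζ ⟨e, h⟩} =
        {e | ∃ h : e ∈ I, 0 < x ⟨e, h⟩} := by
      simp only [zero_mul, add_zero]
    have hmem : ζ ∈ S η ↔ ζ ∈ S 0 := by
      change ({e : Sym2 (Site 2) | ∃ h : e ∈ I, 0 < x ⟨e, h⟩ + η * ζ ⟨e, h⟩} ∈ A) ↔
        ({e : Sym2 (Site 2) | ∃ h : e ∈ I, 0 < x ⟨e, h⟩ + 0 * ζ ⟨e, h⟩} ∈ A)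
      rw [h1, h0]
    by_cases hζ : ζ ∈ S 0
    · rw [indicator_of_mem hζ, indicator_of_mem (hmem.2 hζ)]
    · rw [indicator_of_notMem hζ, indicator_of_notMem (mt hmem.1 hζ)]

/-! ### The registered stub: removing the regularisation -/

/-- **Stub S3 of line `registered` (skeleton v4) of the crux `DriftBound`: removing the noise
regularisation.** For `σ > 0`, every finite edge set `I` and every event `A`,
`regFlow I A η σ → P_ξ({e ∈ I | normNoise σ ξ (m e) > 0} ∈ A)` as `η → 0⁺`.
Almost surely no coordinate `normNoise σ ξ (m e)` vanishes (`sd_ae_smoothedNoise_ne_zero`,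
`pl_normNoise_ne_zero_iff`), so the inner limit `rl_tendsto_regIndicator` holds for almost every
`ξ`; dominated convergence over `ξ` (bound `1`, `regIndicator_mem_Icc`; measurability
`rl_measurable_regIndicator`) gives the limit `E_ξ[regIndicator I A 0 (X̃ ξ)]`, and at `η = 0` the
regularised indicator is the indicator of the (measurable, `rl_measurableSet_cfg_mem`) event
`{ξ | {e ∈ I | normNoise σ ξ (m e) > 0} ∈ A}`, whose integral is its probability. -/
theorem stub_regLimit : ∀ (I : Finset (Sym2 (Literature.Probability.LatticeModels.Site 2))) (A : Set (Set (Sym2 (Literature.Probability.LatticeModels.Site 2)))) (σ : ℝ), 0 < σ → Filter.Tendsto (fun η : ℝ => regFlow I A η σ) (nhdsWithin 0 (Set.Ioi 0)) (nhds (Literature.Probability.Percolation.latticeWhiteNoise.real {ξ | {e : Sym2 (Literature.Probability.LatticeModels.Site 2) | e ∈ I ∧ 0 < normNoise σ ξ (Literature.Probability.LatticeModels.medialPoint 1 e)} ∈ A})) := by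
  intro I A σ hσ
  refine Tendsto.mono_left ?_ nhdsWithin_le_nhds
  set E : Set ((zdGraph 2).edgeSet → ℝ) :=
    {ξ | {e : Sym2 (Site 2) | e ∈ I ∧ 0 < normNoise σ ξ (medialPoint 1 e)} ∈ A} with hE
  set X : ((zdGraph 2).edgeSet → ℝ) → (I → ℝ) := fun ξ i => normNoise σ ξ (medialPoint 1 i.1)
    with hX
  have hXm : Measurable X := measurable_pi_lambda _ fun i => rl_measurable_normNoise σ _
  -- almost surely no coordinate of the normalised field vanishes
  have hae : ∀ᵐ ξ ∂latticeWhiteNoise, ∀ i : I, X ξ i ≠ 0 := by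
    refine ae_all_iff.2 fun i => ?_
    filter_upwards [sd_ae_smoothedNoise_ne_zero hσ (medialPoint 1 i.1)] with ξ hξ
    exact (pl_normNoise_ne_zero_iff hσ ξ _).2 hξ
  -- the two set-builders for the sign configuration of the field agree
  have hcfg : ∀ ξ, {e : Sym2 (Site 2) | ∃ h : e ∈ I, 0 < X ξ ⟨e, h⟩} =
      {e | e ∈ I ∧ 0 < normNoise σ ξ (medialPoint 1 e)} := by
    intro ξ; ext e; simp only [hX, mem_setOf_eq, exists_prop]
  have hEm : MeasurableSet E := by
    have : E = {ξ | {e : Sym2 (Site 2) | ∃ h : e ∈ I, 0 < X ξ ⟨e, h⟩} ∈ A} := by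
      refine Set.ext fun ξ => ?_
      rw [hE]
      simp only [mem_setOf_eq, hcfg ξ]
    rw [this]
    exact rl_measurableSet_cfg_mem I A (fun i ξ => X ξ i) fun i => hXm.eval
  -- at `η = 0` the regularised indicator is the indicator of `E`
  have h0 : ∀ ξ, regIndicator I A 0 (X ξ) = E.indicator 1 ξ := by
    intro ξ
    unfold regIndicator
    simp only [zero_mul, add_zero, hcfg ξ]
    by_cases hmem : ξ ∈ E
    · rw [indicator_of_mem hmem]
      have : {ζ : I → ℝ | {e | e ∈ I ∧ 0 < normNoise σ ξ (medialPoint 1 e)} ∈ A} = univ :=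
        eq_univ_of_forall fun _ => hmem
      rw [this]; simp
    · rw [indicator_of_notMem hmem]
      have : {ζ : I → ℝ | {e | e ∈ I ∧ 0 < normNoise σ ξ (medialPoint 1 e)} ∈ A} = ∅ :=
        eq_empty_of_forall_notMem fun _ h => hmem h
      rw [this]; simp
  -- dominated convergence over the noise
  have hlim : Tendsto (fun η : ℝ => regFlow I A η σ) (𝓝 0)
      (𝓝 (∫ ξ, regIndicator I A 0 (X ξ) ∂latticeWhiteNoise)) := by
    show Tendsto (fun η : ℝ => ∫ ξ, regIndicator I A η (X ξ) ∂latticeWhiteNoise) (𝓝 0)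
      (𝓝 (∫ ξ, regIndicator I A 0 (X ξ) ∂latticeWhiteNoise))
    refine tendsto_integral_filter_of_dominated_convergence (fun _ => (1 : ℝ)) ?_ ?_ ?_ ?_
    · exact Eventually.of_forall fun η =>
        ((rl_measurable_regIndicator I A η).comp hXm).aestronglyMeasurable
    · refine Eventually.of_forall fun η => ae_of_all _ fun ξ => ?_
      have h := regIndicator_mem_Icc I A η (X ξ)
      rw [Real.norm_of_nonneg h.1]
      exact h.2
    · exact integrable_const _
    · filter_upwards [hae] with ξ hξ
      exact rl_tendsto_regIndicator I A hξ
  have hint : ∫ ξ, regIndicator I A 0 (X ξ) ∂latticeWhiteNoise = latticeWhiteNoise.real E := by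
    simp_rw [h0]
    exact integral_indicator_one hEm
  rw [hint] at hlim
  exact hlim

end Summit.CriticalPhenomena.CardyFormulaZ2.Cruxes.DriftBound.Birth

end
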